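import Literature.NumberTheory.LFunctions.KadiriStripEmptiness
import Literature.NumberTheory.LFunctions.KadiriExplicitTerms3
import Literature.NumberTheory.DiophantineGeometry.NamedHypotheses
import HarnessLib

/-!
# Emptiness of the strip in Kadiri's method with a small splitting height `t₀` and the Riemann hypothesis only up to `H ≥ t₀`

Topic `Literature/NumberTheory/LFunctions`. Everything in this file is PROVED (no definition, no
named fact). Companion of `KadiriStripEmptiness.lean` (the strip `1 − 1/(r log γ) ≤ β ≤ 1 − 1/(R log γ)`,
`γ > T₀`, is empty under the certified conditions (N1), (N2) of Mossinghoff–Trudgian's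
optimisation of Kadiri's method). There the method was run as printed — the established region
`R` at ALL heights `|t| ≥ 2` and the numerical verification of RH up to a height `H ≥ T₀` (to
re-cover the heights below `T₀` for the next round; in Mossinghoff–Trudgian–Yang §9 `T₀ = H =
3·10¹²`, Platt–Trudgian). This file separates the roles of the heights so that the large-height
region of Mossinghoff–Trudgian–Yang (leaf (B) of `ExplicitZeroFreeRegion.lean`) needs the Riemann
hypothesis ONLY up to the splitting height `t₀` of the far/near zeros:

* `KadiriStrip3.per_zero_contra` — the per-zero contradiction of `KadiriStrip.per_zero_contra`
  with the THIRD-order far-zero remainder (`KadiriExplicit3.master_explicit`; hypothesis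
  `M₃(−r/R) η₀ ≤ M* t₀` in place of `M(−r/R) ≤ M*`), which keeps the far-zero tail small for a
  small `t₀`;
* `KadiriStrip3.near_zeros`, `zeta_ne_zero_line` — the inputs at the zero under examination from a
  region with constant `R` above a height `T_R` with `T_R + t₀ ≤ γ₀` (the zeros near `kγ₀`,
  `k ≥ 1`) and RH up to `H ≥ t₀` (the zeros within `t₀` of the real point `k = 0`, and `ζ(σ) ≠ 0`);
* `KadiriStrip3.strip_empty` — the strip above `T₀` is empty, given the numerical conditions at a
  certification height `T_c ≤ T₀`, the region `R` above `T_R ≤ T₀ − t₀`, and RH up to `H ≥ t₀`;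
* the glue of the iteration WITHOUT numerical input: `regionAbove_of_stripEmpty` (region `R` above
  `T_R ≤ T₀` + empty strip `(T₀, r, R)` ⇒ region `r` above `T₀`), `regionAbove_initial` (the tree's
  explicit region `riemannZeta_one_sub_re_ge_explicit` ⇒ region `4480 + 74172/log T` above `T`,
  unconditionally), `large_height_of_stripEmpty` (region `R` above `T_R ≤ 3·10¹²` + empty strip
  `(3·10¹², 5.558691, R)` ⇒ leaf (B)), `rh_two_sided` (`RiemannHypothesisUpTo H` in strip form).

With `t₀ = H = 101` (`riemannHypothesisUpTo_hundredOne`, PROVED in the tree by a kernel-checked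
certificate) and four certified rounds at the heights `3·10¹² − 303, −202, −101, 0`, this yields
leaf (B) unconditionally (`KadiriNumerics3Final.lean`).

## References

* H. Kadiri, Acta Arith. 117 (2005) = arXiv:math/0401238, §§2–4. [Kadiri2005]
* M. J. Mossinghoff, T. S. Trudgian, J. Number Theory 157 (2015) = arXiv:1410.3926, (2.2), (3.1),
  §§4–5. [MossinghoffTrudgian2015]
* M. J. Mossinghoff, T. S. Trudgian, A. Yang, Res. Number Theory 10 (2024) = arXiv:2212.06867, §9,
  Table 4. [MossinghoffTrudgianYangRNT2024]
-/

noncomputable section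

open Complex Real MeasureTheory Set Filter

namespace Literature.NumberTheory.LFunctions

namespace KadiriStrip3

variable {θ : ℝ}

set_option maxHeartbeats 8000000 in
/-- **The per-zero contradiction, third-order far-zero remainder** (the statement of
`KadiriStrip.per_zero_contra` with `hMst : M(−r/R) ≤ M*` replaced by `M₃(−r/R) η₀ ≤ M* t₀`).
ORIGINAL DOCSTRING: Fix the parameters of the method and a height `γ₀ ≥ T₀`
(`T₀ ≥ max(7, t₀)`), put `η = 1/(r log γ₀)`, `σ = 1 − 1/(R log(Kγ₀ + t₀))`,
`σ₀ ≤ 1 − 1/(R log(KT₀ + t₀))`, `η₀ ≥ 1/(r log T₀)`, `w₀ ≤ r log T₀/(R log(KT₀+t₀))` (one-sided, so that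
decimal values can be used). Suppose the
hypotheses of `KadiriExplicit.master_explicit` hold at this `σ, η` for a zero `ρ₀` with
`Im ρ₀ = γ₀`, `1 − η ≤ Re ρ₀ ≤ σ`, and the two numerical conditions

* (N1) `q₀ + λ₀ r² log(K+1)/R + q₁ η₀ + q₂ η₀² ≤ 0` (the coefficients `q₀, q₁, q₂` written out in the
  statement; `λ₀ ≥ b₁D(1 − r/R) − b₀D(−w₀)`, `λ₀ ≥ 0`),
* (N2) `g₁(1−κ)A/(2r) < b₁L(1 − r/R) − b₀L(−r/R)` (`A = Σ_{k=1}^{K} b_k`).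

Then `False`. [cite: MossinghoffTrudgian2015, (2.2)] -/
theorem per_zero_contra (hθ : 0 < θ) (hθ' : θ < π / 2) {r R δ κ γ₀ t₀ T₀ Mst m lam0 : ℝ} {K : ℕ}
    {b : ℕ → ℝ} (hb : IsNonnegTrigPoly K b) (hK : 1 ≤ K) (hr : 0 < r) (hR : 0 < R)
    (hδ : 0 ≤ δ) (hδ1 : δ < 1) (hκ0 : 0 ≤ κ) (hκ1 : κ ≤ 1) (hT₀ : 7 ≤ T₀) (ht₀ : 4 ≤ t₀)
    (ht₀T : t₀ ≤ T₀) (hγ₀ : T₀ ≤ γ₀)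
    -- abbreviations (as hypotheses of definitional shape, to keep the statement readable)
    {η σ σ₀ η₀ w₀ : ℝ} (hη : η = 1 / (r * Real.log γ₀))
    (hσ : σ = 1 - 1 / (R * Real.log (K * γ₀ + t₀)))
    (hσ₀ : σ₀ ≤ 1 - 1 / (R * Real.log (K * T₀ + t₀))) (hη₀ : 1 / (r * Real.log T₀) ≤ η₀)
    (hw₀ : w₀ ≤ r * Real.log T₀ / (R * Real.log (K * T₀ + t₀)))
    -- side conditions on the parameters
    (hσ₀half : 1 / 2 < σ₀) (hη₀half : η₀ < 1 / 2) (hδσ₀ : 2 * (1 - σ₀) ≤ δ) (hσ₀δ : 1 < σ₀ + δ)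
    (hκΓ : κ * (σ₀ + 2 + δ) ≤ σ₀ + 2) (hA : κ * (2 * σ₀ - 1 + 2 * δ) ≤ 2 * σ₀ - 1)
    (hSt : κ * (1 + 2 * δ) * (δ + δ ^ 2 + t₀ ^ 2) ≤ (2 * σ₀ - 1) * (t₀ ^ 2 - (1 - σ₀)))
    (hMst : mtyM3 θ (-(r / R)) * η₀ ≤ Mst * t₀)
    (hm : ∀ u ∈ Icc 0 (mtyD1 θ), |mtyH1Deriv2 1 θ u| ≤ m)
    (hlam0 : 0 ≤ lam0)
    (hlam : b 1 * mtyLaplaceMoment θ (1 - r / R) - b 0 * mtyLaplaceMoment θ (-w₀) ≤ lam0)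
    -- the inputs of the master inequality at this zero
    (hζ : ∀ k ≤ K, riemannZeta ((σ : ℂ) + (((k : ℝ) * γ₀ : ℝ) : ℂ) * Complex.I) ≠ 0)
    (hζ' : ∀ k ≤ K, riemannZeta (((σ + δ : ℝ) : ℂ) + (((k : ℝ) * γ₀ : ℝ) : ℂ) * Complex.I) ≠ 0)
    (hnear : ∀ k ≤ K, ∀ ρ : NicolasJExplicit.Zeros, |(ρ : ℂ).im - (k : ℝ) * γ₀| < t₀ →
      1 - σ ≤ (ρ : ℂ).re ∧ (ρ : ℂ).re ≤ σ)
    (hB : ∀ y : ℝ, κ * ((fordLaplace (kadiriTest θ η) ((δ : ℂ) + y * Complex.I)).re +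
        (fordLaplace (kadiriTest θ η) (((2 * σ - 1 + δ : ℝ) : ℂ) + y * Complex.I)).re) ≤
      (fordLaplace (kadiriTest θ η) (((0 : ℝ) : ℂ) + y * Complex.I)).re +
        (fordLaplace (kadiriTest θ η) (((2 * σ - 1 : ℝ) : ℂ) + y * Complex.I)).re)
    (ρ₀ : NicolasJExplicit.Zeros) (hρ₀ : (ρ₀ : ℂ).im = γ₀) (hβlow : 1 - η ≤ (ρ₀ : ℂ).re)
    (hβσ : (ρ₀ : ℂ).re ≤ σ)
    -- (N1) and (N2)
    (hN1 : KadiriStrip.coeffQ0 θ K b r δ κ σ₀ η₀ T₀ t₀ Mst + lam0 * (r ^ 2 * Real.log ((K : ℝ) + 1) / R) +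
      KadiriStrip.coeffQ1 K b r κ σ₀ T₀ t₀ Mst m * η₀ + KadiriStrip.coeffQ2 K b δ κ σ₀ η₀ T₀ m * η₀ ^ 2 ≤ 0)
    (hN2 : fordSmoothW0 θ * (1 - κ) * (∑ k ∈ Finset.range K, b (k + 1)) / (2 * r) <
      b 1 * mtyLaplace θ (1 - r / R) - b 0 * mtyLaplace θ (-(r / R))) :
    False := by
  have hb0 : ∀ k, 0 ≤ b k := hb.1
  have hKr : (1 : ℝ) ≤ K := by exact_mod_cast hK
  have hγ7 : 7 ≤ γ₀ := hT₀.trans hγ₀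
  have hlogγ : 0 < Real.log γ₀ := Real.log_pos (by linarith)
  have hlogT : 0 < Real.log T₀ := Real.log_pos (by linarith)
  have hlogT' : Real.log T₀ ≤ Real.log γ₀ := Real.log_le_log (by linarith) hγ₀
  have hηpos : 0 < η := by rw [hη]; positivity
  have hηη₀ : η ≤ η₀ := by
    rw [hη]; exact le_trans (one_div_le_one_div_of_le (by positivity) (by nlinarith)) hη₀
  have hη₀pos : 0 < η₀ := hηpos.trans_le hηη₀
  have hη2 : η < 1 / 2 := by linarith
  have hηsq : η ^ 2 ≤ η * η₀ := by nlinarith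
  have hηcube : η ^ 3 ≤ η * η₀ ^ 2 := by nlinarith [mul_le_mul hηη₀ hηη₀ hηpos.le hη₀pos.le]
  have hlogKT : 0 < Real.log (K * T₀ + t₀) := Real.log_pos (by nlinarith)
  have hlogKγ : Real.log (K * T₀ + t₀) ≤ Real.log (K * γ₀ + t₀) :=
    Real.log_le_log (by nlinarith) (by nlinarith)
  have hlogKγ0 : 0 < Real.log (K * γ₀ + t₀) := hlogKT.trans_le hlogKγ
  have hσ₀σ : σ₀ ≤ σ := by
    rw [hσ]
    have := one_div_le_one_div_of_le (by positivity) (mul_le_mul_of_nonneg_left hlogKγ hR.le)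
    linarith
  have hσ1 : σ < 1 := by
    have hpos : 0 < 1 / (R * Real.log (K * γ₀ + t₀)) := by positivity
    rw [hσ]; linarith
  have hσhalf : 1 / 2 < σ := by linarith
  have ha₀ : 0 < σ₀ - 1 / 2 := by linarith
  -- `w` and its geometry
  set w : ℝ := (1 - σ) / η with hwdef
  clear_value w
  have hw : w = r * Real.log γ₀ / (R * Real.log (K * γ₀ + t₀)) := by
    rw [hwdef, hσ, hη]; field_simp; ring
  have hw₀w : w₀ ≤ w := by
    have h := kadiri_w_ge_w0 (n := (K : ℝ)) (t₀ := t₀) (T₀ := T₀) (γ₀ := γ₀) (η := η) hr hR hKr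
      (by linarith) (by linarith) hγ₀ hηpos (by rw [hη])
    refine hw₀.trans (h.trans_eq ?_)
    rw [hwdef, hσ]; ring
  have hwlt : w < r / R := by rw [hw]; exact KadiriStrip.w_lt hr hR hKr (by linarith) (by linarith)
  have hsubw : r / R - w ≤ r / R * (Real.log (K + 1) / Real.log γ₀) := by
    rw [hw]; exact KadiriStrip.sub_w_le hr hR hKr (by linarith) (by linarith) (ht₀T.trans hγ₀)
  have hlogγη : Real.log γ₀ = 1 / (r * η) := by rw [hη]; field_simp
  have hrRw : r / R - w ≤ η * (r ^ 2 * Real.log ((K : ℝ) + 1) / R) := by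
    refine hsubw.trans_eq ?_
    rw [hlogγη]; field_simp
  -- the constants of the method
  set g : ℝ := fordSmoothW0 θ with hg
  clear_value g
  have hg0 : 0 < g := by rw [hg]; exact fordSmoothW0_pos hθ hθ'
  have hm0 : 0 ≤ m := (abs_nonneg _).trans (hm 0 ⟨le_rfl, (KadiriTest.mtyD1_pos hθ hθ').le⟩)
  have hMst0 : 0 ≤ Mst := by
    have h1 : 0 ≤ Mst * t₀ := (mul_nonneg (KadiriThird.mtyM3_nonneg hθ hθ' _) hη₀pos.le).trans hMst
    exact (mul_nonneg_iff_of_pos_right (by linarith)).1 h1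
  -- the master inequality at this zero
  have hMσ : ∀ x : ℝ, σ - 1 ≤ x → mtyM3 θ (x / η) * η ≤ Mst * t₀ := by
    intro x hx
    have hanti : mtyM3 θ (x / η) ≤ mtyM3 θ (-(r / R)) := by
      refine KadiriThird.mtyM3_antitone hθ hθ' ?_
      -- `−r/R ≤ x/η` from `x/η ≥ (σ−1)/η = −w > −r/R`
      have h1 : (σ - 1) / η ≤ x / η := div_le_div_of_nonneg_right hx hηpos.le
      have h2 : (σ - 1) / η = -w := by rw [hwdef]; ring
      linarith
    have h3 : mtyM3 θ (x / η) * η ≤ mtyM3 θ (-(r / R)) * η₀ :=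
      mul_le_mul hanti hηη₀ hηpos.le (KadiriThird.mtyM3_nonneg hθ hθ' _)
    exact h3.trans hMst
  have hκσ : κ * (σ - σ₀) ≤ 1 * (σ - σ₀) := mul_le_mul_of_nonneg_right hκ1 (by linarith)
  have hκΓσ : κ * (σ + 2 + δ) ≤ σ + 2 := by linarith
  have hAσ : κ * (2 * σ - 1 + 2 * δ) ≤ 2 * σ - 1 := by linarith
  have hStσ : κ * (2 * σ - 1 + 2 * δ) * (-(1 - σ) + (2 * σ - 1) * δ + δ ^ 2 + t₀ ^ 2) ≤
      (2 * σ - 1) * (-(1 - σ) + t₀ ^ 2) := by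
    have h1 : κ * (2 * σ - 1 + 2 * δ) ≤ κ * (1 + 2 * δ) := mul_le_mul_of_nonneg_left (by linarith) hκ0
    have hδσ : (2 * σ - 1) * δ ≤ 1 * δ := mul_le_mul_of_nonneg_right (by linarith) hδ
    have h2 : -(1 - σ) + (2 * σ - 1) * δ + δ ^ 2 + t₀ ^ 2 ≤ δ + δ ^ 2 + t₀ ^ 2 := by linarith
    have ht16 : 16 ≤ t₀ ^ 2 := by nlinarith
    have hδσ' : 0 ≤ (2 * σ - 1) * δ := mul_nonneg (by linarith) hδ
    have h3 : 0 ≤ -(1 - σ) + (2 * σ - 1) * δ + δ ^ 2 + t₀ ^ 2 := by nlinarith [sq_nonneg δ]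
    have h4 : 0 ≤ κ * (1 + 2 * δ) := by positivity
    have h5 : (2 * σ₀ - 1) * (t₀ ^ 2 - (1 - σ₀)) ≤ (2 * σ - 1) * (-(1 - σ) + t₀ ^ 2) :=
      mul_le_mul (by linarith) (by linarith) (by linarith) (by linarith)
    calc κ * (2 * σ - 1 + 2 * δ) * (-(1 - σ) + (2 * σ - 1) * δ + δ ^ 2 + t₀ ^ 2)
        ≤ κ * (1 + 2 * δ) * (δ + δ ^ 2 + t₀ ^ 2) := mul_le_mul h1 h2 h3 h4
      _ ≤ _ := hSt.trans h5
  have HM := KadiriExplicit3.master_explicit hθ hθ' hηpos (σ₀ := σ₀) (σ := σ) (δ := δ) (κ := κ)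
    (γ₀ := γ₀) (t₀ := t₀) (T₀ := T₀) (Mst := Mst) (m := m) hb hK hσ₀half hσ₀σ hσ1 hδ hδ1
    (by linarith) hκ0 hκ1 hκΓσ hT₀ hγ₀ ht₀ ht₀T hζ hζ' hnear hB hAσ hStσ hMσ hm
    (KadiriDigammaIntegral.J_zero_le ha₀) (fun t ht ↦ KadiriDigammaIntegral.J_le_log ha₀ (by linarith))
    ρ₀ hρ₀ hβlow hβσ hη2
  -- the `L`-arguments in terms of `w`
  have hηne : η ≠ 0 := hηpos.ne'
  have e1 : (σ - (1 - η)) / η = 1 - w := by rw [hwdef]; field_simp; ring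
  have e2 : (σ - 1) / η = -w := by rw [hwdef]; ring
  have e3 : (σ + δ - 1 + (1 - η)) / η = (σ + δ - η) / η := by ring
  rw [e1, e2, e3] at HM
  -- third-order bounds on the four auxiliary `L`-values
  have hX₁ : 0 < 1 / η := by positivity
  have hδpos : 0 < δ := by linarith
  have hX₂ : 0 < δ / η := by positivity
  have hden₃ : 0 < σ₀ + δ - η₀ := by linarith
  have hden₃' : σ₀ + δ - η₀ ≤ σ + δ - η := by linarith
  have hX₃ : 0 < (σ + δ - η) / η := div_pos (by linarith) hηpos
  have hden₄ : 0 < σ₀ + δ - 1 := by linarith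
  have hden₄' : σ₀ + δ - 1 ≤ σ + δ - 1 := by linarith
  have hden₄'' : σ + δ - 1 ≤ δ := by linarith
  have hX₄ : 0 < (σ + δ - 1) / η := div_pos (by linarith) hηpos
  have hL1 := (abs_le.1 (KadiriExplicit.abs_mtyLaplace_sub_le hθ hθ' hX₁ hm)).1
  have hL2 := (abs_le.1 (KadiriExplicit.abs_mtyLaplace_sub_le hθ hθ' hX₂ hm)).2
  have hL3 := (abs_le.1 (KadiriExplicit.abs_mtyLaplace_sub_le hθ hθ' hX₃ hm)).2
  have hL4 := (abs_le.1 (KadiriExplicit.abs_mtyLaplace_sub_le hθ hθ' hX₄ hm)).1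
  -- rewrite the rational functions of `1/η` etc.
  have r1 : fordSmoothW0 θ / (1 / η) = g * η := by rw [hg]; field_simp
  have r1' : m / (1 / η) ^ 3 = m * η ^ 3 := by field_simp
  have r2 : fordSmoothW0 θ / (δ / η) = g * η / δ := by rw [hg]; field_simp
  have r2' : m / (δ / η) ^ 3 = m * η ^ 3 / δ ^ 3 := by field_simp
  have r3 : fordSmoothW0 θ / ((σ + δ - η) / η) = g * η / (σ + δ - η) := by rw [hg]; field_simp
  have r3' : m / ((σ + δ - η) / η) ^ 3 = m * η ^ 3 / (σ + δ - η) ^ 3 := by field_simp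
  have r4 : fordSmoothW0 θ / ((σ + δ - 1) / η) = g * η / (σ + δ - 1) := by rw [hg]; field_simp
  have r4' : m / ((σ + δ - 1) / η) ^ 3 = m * η ^ 3 / (σ + δ - 1) ^ 3 := by field_simp
  rw [r1, r1'] at hL1
  rw [r2, r2'] at hL2
  rw [r3, r3'] at hL3
  rw [r4, r4'] at hL4
  -- monotone replacements in `σ`, `η`
  have hgη : 0 ≤ g * η := by positivity
  have hmη : 0 ≤ m * η ^ 3 := by positivity
  have hL3' : mtyLaplace θ ((σ + δ - η) / η) ≤ g * η / (σ₀ + δ - η₀) + m * η ^ 3 / (σ₀ + δ - η₀) ^ 3 := by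
    have h1 : g * η / (σ + δ - η) ≤ g * η / (σ₀ + δ - η₀) :=
      div_le_div_of_nonneg_left hgη hden₃ hden₃'
    have h2 : m * η ^ 3 / (σ + δ - η) ^ 3 ≤ m * η ^ 3 / (σ₀ + δ - η₀) ^ 3 :=
      div_le_div_of_nonneg_left hmη (by positivity) (pow_le_pow_left₀ hden₃.le hden₃' 3)
    linarith
  have hL4' : g * η / δ - m * η ^ 3 / (σ₀ + δ - 1) ^ 3 ≤ mtyLaplace θ ((σ + δ - 1) / η) := by
    have h1 : g * η / δ ≤ g * η / (σ + δ - 1) :=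
      div_le_div_of_nonneg_left hgη (by linarith) hden₄''
    have h2 : m * η ^ 3 / (σ + δ - 1) ^ 3 ≤ m * η ^ 3 / (σ₀ + δ - 1) ^ 3 :=
      div_le_div_of_nonneg_left hmη (by positivity) (pow_le_pow_left₀ hden₄.le hden₄' 3)
    linarith
  -- the per-`k` identity (`log γ₀ = 1/(rη)`)
  have hrne : r ≠ 0 := hr.ne'
  set S₁ : ℝ := ∑ k ∈ Finset.range K, b (k + 1) *
    (g * ((1 - κ) / 2 * (Real.log ((k + 1 : ℕ) : ℝ) - Real.log (2 * π)) + 5 / T₀ ^ 2) +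
      (1 + κ) * g / T₀ ^ 2 + (1 + κ) * Mst * 90 * (1 / t₀ ^ 2 + 1 / t₀) / r) with hS₁
  clear_value S₁
  set S₂ : ℝ := ∑ k ∈ Finset.range K, b (k + 1) *
    ((1 + κ) * Mst / T₀ ^ 2 + (1 + κ) * m * (π / (σ₀ - 1 / 2)) / (2 * π * (σ₀ - 1 / 2) * r) +
      (1 + κ) * Mst * (3 * ((154 + 30 * (Real.log ((k + 1 : ℕ) : ℝ) + 1)) * (1 / t₀ ^ 2 + 1 / t₀) +
        30 * (Real.log t₀ / t₀ ^ 2 + (Real.log t₀ + 1) / t₀)))) with hS₂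
  clear_value S₂
  set S₃ : ℝ := ∑ k ∈ Finset.range K, b (k + 1) * ((1 + κ) * m * (2 / T₀ ^ 2 +
    (π / (σ₀ - 1 / 2) * Real.log ((k + 1 : ℕ) : ℝ) +
      (π / (σ₀ - 1 / 2) * (12 + Real.log 2) + (4 / (σ₀ - 1 / 2) ^ 2 + 8))) / (2 * π * (σ₀ - 1 / 2)))) with hS₃
  clear_value S₃
  set Asum : ℝ := ∑ k ∈ Finset.range K, b (k + 1) with hAsum
  clear_value Asum
  have hsum : ∑ k ∈ Finset.range K, b (k + 1) *
      (η * fordSmoothW0 θ * ((1 - κ) / 2 * (Real.log ((k + 1 : ℕ) : ℝ) + Real.log γ₀) -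
          (1 - κ) / 2 * Real.log (2 * π) + 5 / T₀ ^ 2) +
        (1 + κ) * (η * fordSmoothW0 θ + Mst * η ^ 2) / T₀ ^ 2 +
        (1 + κ) * (m * η ^ 3) * (2 / T₀ ^ 2 +
          (π / (σ₀ - 1 / 2) * (Real.log ((k + 1 : ℕ) : ℝ) + Real.log γ₀) +
            (π / (σ₀ - 1 / 2) * (12 + Real.log 2) + (4 / (σ₀ - 1 / 2) ^ 2 + 8))) / (2 * π * (σ₀ - 1 / 2))) +
        (1 + κ) * Mst * η ^ 2 * (3 * ((154 + 30 * (Real.log ((k + 1 : ℕ) : ℝ) + Real.log γ₀ + 1)) *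
          (1 / t₀ ^ 2 + 1 / t₀) + 30 * (Real.log t₀ / t₀ ^ 2 + (Real.log t₀ + 1) / t₀)))) =
      g * (1 - κ) / (2 * r) * Asum + η * S₁ + η ^ 2 * S₂ + η ^ 3 * S₃ := by
    rw [hS₁, hS₂, hS₃, hAsum, Finset.mul_sum, Finset.mul_sum, Finset.mul_sum, Finset.mul_sum,
      ← Finset.sum_add_distrib, ← Finset.sum_add_distrib, ← Finset.sum_add_distrib]
    refine Finset.sum_congr rfl fun k _ ↦ ?_
    rw [hlogγη, hg]
    have ha₀ne : σ₀ - 1 / 2 ≠ 0 := ha₀.ne'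
    have h2a : 2 * σ₀ - 1 ≠ 0 := by linarith
    have hT₀ne : T₀ ≠ 0 := by linarith
    have ht₀ne : t₀ ≠ 0 := by linarith
    field_simp
    ring
  rw [hsum] at HM
  clear hsum
  -- names for the remaining atoms
  set L₁ := mtyLaplace θ (1 / η) with hL₁
  clear_value L₁
  set L₂ := mtyLaplace θ (δ / η) with hL₂
  clear_value L₂
  set L₃ := mtyLaplace θ ((σ + δ - η) / η) with hL₃
  clear_value L₃
  set L₄ := mtyLaplace θ ((σ + δ - 1) / η) with hL₄
  clear_value L₄
  set Lw₁ := mtyLaplace θ (1 - w) with hLw₁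
  clear_value Lw₁
  set Lw₀ := mtyLaplace θ (-w) with hLw₀
  clear_value Lw₀
  set c₁₀ : ℝ := -((1 - κ) / 2) * Real.log π + (Complex.digamma ((3 / 2 : ℝ) : ℂ)).re / 2 -
    κ / 2 * (Complex.digamma ((((σ₀ + δ) / 2 + 1 : ℝ)) : ℂ)).re with hc₁₀
  clear_value c₁₀
  set tB₀ : ℝ := KadiriTail.tailBound 0 t₀ with htB₀
  clear_value tB₀
  set J₀ : ℝ := π / (σ₀ - 1 / 2) * (Real.log 3 + 12) + (4 / (σ₀ - 1 / 2) ^ 2 + 8) with hJ₀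
  clear_value J₀
  -- the main linear consequence of `HM` and the third-order bounds
  have hq : b 1 * Lw₁ - b 0 * Lw₀ ≤
      (η * (-(b 1) * g + κ * b 1 * g * (1 / δ + 1 / (σ₀ + δ - η₀)) - κ * b 0 * g / δ) +
        η ^ 3 * (b 1 * m + κ * b 1 * m * (1 / δ ^ 3 + 1 / (σ₀ + δ - η₀) ^ 3) + κ * b 0 * m / (σ₀ + δ - 1) ^ 3)) +
      b 0 * (η * g * c₁₀ + (1 + κ) * (m * η ^ 3) * (1 / σ₀ ^ 3 + J₀ / (2 * π * (σ₀ - 1 / 2))) +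
        (1 + κ) * Mst * η ^ 2 * (3 * tB₀)) +
      (g * (1 - κ) / (2 * r) * Asum + η * S₁ + η ^ 2 * S₂ + η ^ 3 * S₃) := by
    have hb1 := hb0 1
    have hb0' := hb0 0
    -- `HM` : b1 (Lw₁ + L₁ − κ(L₂ + L₃)) ≤ b0 (ηg c₁₀ + (Lw₀ − κL₄) + (1+κ)(mη³)(1/σ₀³+J₀/(2π a₀)) + (1+κ)Mst η²(3tB₀)) + (…)
    have t1 : -(b 1 * L₁) ≤ -(b 1) * (g * η - m * η ^ 3) := by
      have := mul_le_mul_of_nonneg_left hL1 hb1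
      linarith
    have t2 : κ * b 1 * L₂ ≤ κ * b 1 * (g * η / δ + m * η ^ 3 / δ ^ 3) :=
      mul_le_mul_of_nonneg_left (by linarith) (by positivity)
    have t3 : κ * b 1 * L₃ ≤ κ * b 1 * (g * η / (σ₀ + δ - η₀) + m * η ^ 3 / (σ₀ + δ - η₀) ^ 3) :=
      mul_le_mul_of_nonneg_left hL3' (by positivity)
    have t4 : -(κ * b 0 * L₄) ≤ -(κ * b 0 * (g * η / δ - m * η ^ 3 / (σ₀ + δ - 1) ^ 3)) := by
      have := mul_le_mul_of_nonneg_left hL4' (by positivity : 0 ≤ κ * b 0)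
      linarith
    have HM' := HM
    simp only [hg.symm] at HM'
    have step1 : b 1 * Lw₁ - b 0 * Lw₀ ≤ (-(b 1 * L₁) + κ * b 1 * L₂ + κ * b 1 * L₃ - κ * b 0 * L₄) +
        b 0 * (η * g * c₁₀ + (1 + κ) * (m * η ^ 3) * (1 / σ₀ ^ 3 + J₀ / (2 * π * (σ₀ - 1 / 2))) +
          (1 + κ) * Mst * η ^ 2 * (3 * tB₀)) +
        (g * (1 - κ) / (2 * r) * Asum + η * S₁ + η ^ 2 * S₂ + η ^ 3 * S₃) := by
      linear_combination HM'
    have step2' : (-(b 1 * L₁) + κ * b 1 * L₂ + κ * b 1 * L₃ - κ * b 0 * L₄) ≤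
        -(b 1) * (g * η - m * η ^ 3) + κ * b 1 * (g * η / δ + m * η ^ 3 / δ ^ 3) +
          κ * b 1 * (g * η / (σ₀ + δ - η₀) + m * η ^ 3 / (σ₀ + δ - η₀) ^ 3) -
          κ * b 0 * (g * η / δ - m * η ^ 3 / (σ₀ + δ - 1) ^ 3) := by linear_combination t1 + t2 + t3 + t4
    have e3 : -(b 1) * (g * η - m * η ^ 3) + κ * b 1 * (g * η / δ + m * η ^ 3 / δ ^ 3) +
          κ * b 1 * (g * η / (σ₀ + δ - η₀) + m * η ^ 3 / (σ₀ + δ - η₀) ^ 3) -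
          κ * b 0 * (g * η / δ - m * η ^ 3 / (σ₀ + δ - 1) ^ 3) =
        η * (-(b 1) * g + κ * b 1 * g * (1 / δ + 1 / (σ₀ + δ - η₀)) - κ * b 0 * g / δ) +
        η ^ 3 * (b 1 * m + κ * b 1 * m * (1 / δ ^ 3 + 1 / (σ₀ + δ - η₀) ^ 3) + κ * b 0 * m / (σ₀ + δ - 1) ^ 3) := by
      ring
    have step2 := step2'.trans_eq e3
    linear_combination step1 + step2
  clear HM
  -- the Lipschitz step
  have hKdiff : (b 1 * mtyLaplace θ (1 - r / R) - b 0 * mtyLaplace θ (-(r / R))) - (b 1 * Lw₁ - b 0 * Lw₀) ≤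
      η * (lam0 * (r ^ 2 * Real.log ((K : ℝ) + 1) / R)) := by
    have h1 := KadiriStrip.kadiriK_sub_le hθ hθ' (b₀ := b 0) (b₁ := b 1) (hb0 0) (hb0 1) w (r / R)
    have h2 : b 1 * mtyLaplaceMoment θ (1 - r / R) - b 0 * mtyLaplaceMoment θ (-w) ≤ lam0 := by
      have := KadiriStrip.mtyLaplaceMoment_antitone hθ hθ' (show -w ≤ -w₀ by linarith)
      have := mul_le_mul_of_nonneg_left this (hb0 0)
      linarith
    have h3 : (r / R - w) * (b 1 * mtyLaplaceMoment θ (1 - r / R) - b 0 * mtyLaplaceMoment θ (-w)) ≤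
        (r / R - w) * lam0 := mul_le_mul_of_nonneg_left h2 (by linarith)
    have h4 : (r / R - w) * lam0 ≤ η * (r ^ 2 * Real.log ((K : ℝ) + 1) / R) * lam0 :=
      mul_le_mul_of_nonneg_right hrRw hlam0
    rw [hLw₁, hLw₀]
    linarith [h1, h3, h4]
  -- signs of the higher coefficients, and `η ≤ η₀`
  have hlog1 : ∀ k : ℕ, 0 ≤ Real.log ((k + 1 : ℕ) : ℝ) := fun k ↦
    Real.log_nonneg (by norm_cast; omega)
  have hlogt₀ : 0 ≤ Real.log t₀ := Real.log_nonneg (by linarith)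
  have htB₀0 : 0 ≤ tB₀ := by rw [htB₀]; exact KadiriTail.tailBound_nonneg le_rfl (by linarith)
  have hJ₀0 : 0 ≤ J₀ := by
    have : 0 ≤ Real.log 3 := Real.log_nonneg (by norm_num)
    rw [hJ₀]; positivity
  have hS₂0 : 0 ≤ S₂ := by
    rw [hS₂]
    refine Finset.sum_nonneg fun k _ ↦ mul_nonneg (hb0 _) ?_
    have := hlog1 k
    positivity
  have hS₃0 : 0 ≤ S₃ := by
    rw [hS₃]
    refine Finset.sum_nonneg fun k _ ↦ mul_nonneg (hb0 _) ?_
    have := hlog1 k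
    have : 0 ≤ Real.log 2 := Real.log_nonneg (by norm_num)
    positivity
  set q₁ : ℝ := b 0 * ((1 + κ) * Mst * (3 * tB₀)) + S₂ with hq₁
  clear_value q₁
  set q₂ : ℝ := (b 1 * m + κ * b 1 * m * (1 / δ ^ 3 + 1 / (σ₀ + δ - η₀) ^ 3) + κ * b 0 * m / (σ₀ + δ - 1) ^ 3 +
    b 0 * ((1 + κ) * m * (1 / σ₀ ^ 3 + J₀ / (2 * π * (σ₀ - 1 / 2))))) + S₃ with hq₂
  clear_value q₂
  have hq₁0 : 0 ≤ q₁ := by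
    rw [hq₁]
    refine add_nonneg (mul_nonneg (hb0 0) (mul_nonneg (mul_nonneg (by linarith) hMst0) (by linarith))) hS₂0
  have hq₂0 : 0 ≤ q₂ := by
    rw [hq₂]
    have hb1 := hb0 1
    have hb0' := hb0 0
    have h1 : 0 ≤ 1 / δ ^ 3 + 1 / (σ₀ + δ - η₀) ^ 3 := by positivity
    have h2 : 0 ≤ 1 / σ₀ ^ 3 + J₀ / (2 * π * (σ₀ - 1 / 2)) :=
      add_nonneg (by positivity) (div_nonneg hJ₀0 (by positivity))
    have h3 : 0 ≤ κ * b 0 * m / (σ₀ + δ - 1) ^ 3 := div_nonneg (by positivity) (pow_nonneg hden₄.le 3)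
    have : 0 ≤ b 1 * m + κ * b 1 * m * (1 / δ ^ 3 + 1 / (σ₀ + δ - η₀) ^ 3) + κ * b 0 * m / (σ₀ + δ - 1) ^ 3 +
        b 0 * ((1 + κ) * m * (1 / σ₀ ^ 3 + J₀ / (2 * π * (σ₀ - 1 / 2)))) := by positivity
    linarith
  have hpow2 : η ^ 2 * q₁ ≤ η * η₀ * q₁ := mul_le_mul_of_nonneg_right hηsq hq₁0
  have hpow3 : η ^ 3 * q₂ ≤ η * η₀ ^ 2 * q₂ := mul_le_mul_of_nonneg_right hηcube hq₂0
  -- the coefficients of the statement are the ones assembled here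
  have hQ0 : KadiriStrip.coeffQ0 θ K b r δ κ σ₀ η₀ T₀ t₀ Mst =
      (-(b 1) * g + κ * b 1 * g * (1 / δ + 1 / (σ₀ + δ - η₀)) - κ * b 0 * g / δ + b 0 * g * c₁₀) + S₁ := by
    rw [hS₁, hc₁₀, hg]; rfl
  have hQ1 : KadiriStrip.coeffQ1 K b r κ σ₀ T₀ t₀ Mst m = q₁ := by rw [hq₁, htB₀, hS₂]; rfl
  have hQ2 : KadiriStrip.coeffQ2 K b δ κ σ₀ η₀ T₀ m = q₂ := by rw [hq₂, hJ₀, hS₃]; rfl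
  rw [hQ0, hQ1, hQ2] at hN1
  clear hQ0 hQ1 hQ2
  -- conclude
  have hfin := mul_nonpos_of_nonneg_of_nonpos hηpos.le hN1
  have hq₁η : η ^ 2 * q₁ = η ^ 2 * (b 0 * ((1 + κ) * Mst * (3 * tB₀)) + S₂) := by rw [hq₁]
  have hq₂η : η ^ 3 * q₂ = η ^ 3 * ((b 1 * m + κ * b 1 * m * (1 / δ ^ 3 + 1 / (σ₀ + δ - η₀) ^ 3) +
      κ * b 0 * m / (σ₀ + δ - 1) ^ 3 + b 0 * ((1 + κ) * m * (1 / σ₀ ^ 3 + J₀ / (2 * π * (σ₀ - 1 / 2))))) + S₃) := by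
    rw [hq₂]
  have hA1 : b 1 * Lw₁ - b 0 * Lw₀ ≤
      η * (-(b 1) * g + κ * b 1 * g * (1 / δ + 1 / (σ₀ + δ - η₀)) - κ * b 0 * g / δ) + η * (b 0 * g * c₁₀) +
        η * S₁ + g * (1 - κ) / (2 * r) * Asum + η ^ 2 * q₁ + η ^ 3 * q₂ := by
    rw [hq₁η, hq₂η]; linear_combination hq
  have hA2 : b 1 * Lw₁ - b 0 * Lw₀ ≤
      g * (1 - κ) / (2 * r) * Asum - η * (lam0 * (r ^ 2 * Real.log ((K : ℝ) + 1) / R)) := by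
    linear_combination hA1 + hpow2 + hpow3 + hfin
  have hA3 : b 1 * mtyLaplace θ (1 - r / R) - b 0 * mtyLaplace θ (-(r / R)) ≤
      g * (1 - κ) / (2 * r) * Asum := by linear_combination hA2 + hKdiff
  have hA4 : g * (1 - κ) * Asum / (2 * r) = g * (1 - κ) / (2 * r) * Asum := by ring
  linarith [hA3, hA4, hN2]

/-! ## Part C: the inputs of the master inequality from a region ABOVE A HEIGHT and RH up to `H ≥ t₀` -/

/-- The zeros near the heights `kγ₀` lie in `1 − σ ≤ β ≤ σ` (`σ = 1 − 1/(R log(Kγ₀ + t₀))`), given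
the classical region with constant `R` at the heights `γ > T_R` with `T_R + t₀ ≤ γ₀` (this covers
the zeros near `kγ₀`, `k ≥ 1`; reflect `ρ ↦ 1 − ρ̄` for the lower bound) and the Riemann hypothesis
up to a height `H ≥ t₀` (this covers the zeros near the real point, `k = 0`).
[cite: Kadiri2005, §2.3] -/
theorem near_zeros {R t₀ H T_R γ₀ σ : ℝ} {K : ℕ} (hR : 0 < R) (ht₀ : 4 ≤ t₀) (hH : t₀ ≤ H)
    (hTR2 : 2 ≤ T_R) (hγ₀ : T_R + t₀ ≤ γ₀)
    (hσ : σ = 1 - 1 / (R * Real.log (K * γ₀ + t₀))) (hσhalf : 1 / 2 ≤ σ)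
    (hReg : ∀ β γ : ℝ, T_R < γ → riemannZeta (β + γ * I) = 0 → β ≤ 1 - 1 / (R * Real.log γ))
    (hRH : ∀ s : ℂ, riemannZeta s = 0 → 0 < s.re → s.re < 1 → |s.im| ≤ H → s.re = 1 / 2) :
    ∀ k ≤ K, ∀ ρ : NicolasJExplicit.Zeros, |(ρ : ℂ).im - (k : ℝ) * γ₀| < t₀ →
      1 - σ ≤ (ρ : ℂ).re ∧ (ρ : ℂ).re ≤ σ := by
  intro k hk ρ hρ
  have hmem := ρ.2
  have hz := ZetaZeros.riemannZetaNontrivialZeros.zeta_eq_zero hmem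
  have hre0 := ZetaZeros.riemannZetaNontrivialZeros.re_pos hmem
  have hre1 := ZetaZeros.riemannZetaNontrivialZeros.re_lt_one hmem
  have hγ₀0 : 0 ≤ γ₀ := by linarith
  rcases Nat.eq_zero_or_pos k with hk0 | hkpos
  · -- `k = 0`: `|γ| < t₀ ≤ H`, RH
    subst hk0
    have habs : |(ρ : ℂ).im| ≤ H := by
      simp only [Nat.cast_zero, zero_mul, sub_zero] at hρ
      linarith
    have := hRH _ hz hre0 hre1 habs
    constructor <;> linarith
  · -- `k ≥ 1`: `γ > kγ₀ − t₀ ≥ γ₀ − t₀ ≥ T_R`, the region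
    have hk1 : (1 : ℝ) ≤ k := by exact_mod_cast hkpos
    have hkK : (k : ℝ) * γ₀ ≤ K * γ₀ := mul_le_mul_of_nonneg_right (by exact_mod_cast hk) hγ₀0
    have hkγ : γ₀ ≤ (k : ℝ) * γ₀ := by nlinarith
    have hlow : (k : ℝ) * γ₀ - t₀ < (ρ : ℂ).im := by
      have := (abs_lt.1 hρ).1; linarith
    have hup' : (ρ : ℂ).im < K * γ₀ + t₀ := by
      have := (abs_lt.1 hρ).2; linarith
    have hTγ : T_R < (ρ : ℂ).im := by linarith
    have h2 : 2 < (ρ : ℂ).im := by linarith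
    have hlog0 : 0 < Real.log (ρ : ℂ).im := Real.log_pos (by linarith)
    have hlogle : Real.log (ρ : ℂ).im ≤ Real.log (K * γ₀ + t₀) := Real.log_le_log (by linarith) hup'.le
    have hmono : 1 - 1 / (R * Real.log (ρ : ℂ).im) ≤ σ := by
      rw [hσ]
      have := one_div_le_one_div_of_le (by positivity) (mul_le_mul_of_nonneg_left hlogle hR.le)
      linarith
    constructor
    · -- the reflected zero `1 − ρ̄`
      have hmem' := ZetaZeros.riemannZetaNontrivialZeros.one_sub_conj_mem hmem
      have hz' := ZetaZeros.riemannZetaNontrivialZeros.zeta_eq_zero hmem'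
      have e : (1 - (starRingEnd ℂ) (ρ : ℂ)) = ((1 - (ρ : ℂ).re : ℝ) : ℂ) + (((ρ : ℂ).im : ℝ) : ℂ) * I := by
        apply Complex.ext <;> simp
      rw [e] at hz'
      have := hReg (1 - (ρ : ℂ).re) (ρ : ℂ).im hTγ hz'
      linarith
    · have e : (ρ : ℂ) = (((ρ : ℂ).re : ℝ) : ℂ) + (((ρ : ℂ).im : ℝ) : ℂ) * I := (Complex.re_add_im _).symm
      have hz'' : riemannZeta ((((ρ : ℂ).re : ℝ) : ℂ) + (((ρ : ℂ).im : ℝ) : ℂ) * I) = 0 := by rwa [← e]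
      have := hReg (ρ : ℂ).re (ρ : ℂ).im hTγ hz''
      linarith

/-- `ζ(σ + ikγ₀) ≠ 0` for `k ≤ K` (`σ = 1 − 1/(R log(Kγ₀+t₀)) > 1/2`), from the region with constant
`R` above the height `T_R < γ₀` (`k ≥ 1`) and RH up to `H` (`k = 0`, a real point).
[cite: Kadiri2005, §2.3] -/
theorem zeta_ne_zero_line {R t₀ H T_R γ₀ σ : ℝ} {K : ℕ} (hR : 0 < R) (ht₀ : 4 ≤ t₀) (hH : t₀ ≤ H)
    (hTR2 : 2 ≤ T_R) (hγ₀ : T_R + t₀ ≤ γ₀) (hσ : σ = 1 - 1 / (R * Real.log (K * γ₀ + t₀)))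
    (hσhalf : 1 / 2 < σ)
    (hReg : ∀ β γ : ℝ, T_R < γ → riemannZeta (β + γ * I) = 0 → β ≤ 1 - 1 / (R * Real.log γ))
    (hRH : ∀ s : ℂ, riemannZeta s = 0 → 0 < s.re → s.re < 1 → |s.im| ≤ H → s.re = 1 / 2) :
    ∀ k ≤ K, riemannZeta ((σ : ℂ) + (((k : ℝ) * γ₀ : ℝ) : ℂ) * I) ≠ 0 := by
  intro k hk hz
  set s : ℂ := (σ : ℂ) + (((k : ℝ) * γ₀ : ℝ) : ℂ) * I with hs
  have hsre : s.re = σ := by simp [hs]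
  have hsim : s.im = (k : ℝ) * γ₀ := by simp [hs]
  have hmem := ZetaZeros.riemannZetaNontrivialZeros.mem_of_re_pos hz (by rw [hsre]; linarith)
  have hγ₀0 : 0 ≤ γ₀ := by linarith
  rcases Nat.eq_zero_or_pos k with hk0 | hkpos
  · subst hk0
    have habs : |s.im| ≤ H := by rw [hsim]; simp; linarith
    have := hRH s hz (by rw [hsre]; linarith) (ZetaZeros.riemannZetaNontrivialZeros.re_lt_one hmem) habs
    rw [hsre] at this; linarith
  · have hk1 : (1 : ℝ) ≤ k := by exact_mod_cast hkpos
    have hkK : (k : ℝ) * γ₀ ≤ K * γ₀ := mul_le_mul_of_nonneg_right (by exact_mod_cast hk) hγ₀0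
    have hkγ : γ₀ ≤ (k : ℝ) * γ₀ := by nlinarith
    have hTγ : T_R < (k : ℝ) * γ₀ := by linarith
    have h2 : 2 < (k : ℝ) * γ₀ := by linarith
    have hlt : (k : ℝ) * γ₀ < K * γ₀ + t₀ := by linarith
    have hlog0 : 0 < Real.log ((k : ℝ) * γ₀) := Real.log_pos (by linarith)
    have hloglt : Real.log ((k : ℝ) * γ₀) < Real.log (K * γ₀ + t₀) := Real.log_lt_log (by linarith) hlt
    have := hReg σ ((k : ℝ) * γ₀) hTγ hz
    have hstrict : 1 - 1 / (R * Real.log ((k : ℝ) * γ₀)) < σ := by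
      rw [hσ]
      have := one_div_lt_one_div_of_lt (by positivity) (mul_lt_mul_of_pos_left hloglt hR)
      linarith
    linarith

set_option maxHeartbeats 1600000 in
/-- **The strip `1 − 1/(r log γ) ≤ β ≤ 1 − 1/(R log γ)`, `γ > T₀`, is free of zeros** under the
numerical conditions (N1), (N2) of `per_zero_contra` certified at a height `T_c ≤ T₀`
(`T_c ≥ max(7, t₀)`), Kadiri's side conditions on `κ, δ`, the boundary-inequality criterion at
`(σ₀, η₀)`, the classical region with constant `R` at the heights `γ > T_R` with `T_R + t₀ ≤ T₀`,
and the Riemann hypothesis up to a height `H ≥ t₀` (used only for the zeros within `t₀` of the real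
axis and for `ζ(σ) ≠ 0`), with the third-order far-zero remainder (`hMst : M₃(−r/R) η₀ ≤ M* t₀`).
[cite: MossinghoffTrudgian2015, (2.2) and §5; MossinghoffTrudgianYangRNT2024, §9] -/
theorem strip_empty (hθ : 0 < θ) (hθ' : θ < π / 2) {r R δ κ t₀ T_c T_R T₀ H Mst m lam0 σ₀ η₀ w₀ : ℝ}
    {K : ℕ} {b : ℕ → ℝ} (hb : IsNonnegTrigPoly K b) (hK : 1 ≤ K) (hr : 0 < r) (hR : 0 < R)
    (hδ : 0 ≤ δ) (hδ1 : δ < 1) (hκ0 : 0 ≤ κ) (hκ1 : κ ≤ 1) (hT_c : 7 ≤ T_c) (ht₀ : 4 ≤ t₀)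
    (ht₀T : t₀ ≤ T_c) (hTc : T_c ≤ T₀) (hH : t₀ ≤ H) (hTR2 : 2 ≤ T_R) (hTR : T_R + t₀ ≤ T₀)
    (hσ₀ : σ₀ ≤ 1 - 1 / (R * Real.log (K * T_c + t₀))) (hη₀ : 1 / (r * Real.log T_c) ≤ η₀)
    (hw₀ : w₀ ≤ r * Real.log T_c / (R * Real.log (K * T_c + t₀)))
    (hσ₀half : 1 / 2 < σ₀) (hη₀half : η₀ < 1 / 2) (hδσ₀ : 2 * (1 - σ₀) ≤ δ) (hσ₀δ : 1 < σ₀ + δ)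
    (hκΓ : κ * (σ₀ + 2 + δ) ≤ σ₀ + 2) (hA : κ * (2 * σ₀ - 1 + 2 * δ) ≤ 2 * σ₀ - 1)
    (hSt : κ * (1 + 2 * δ) * (δ + δ ^ 2 + t₀ ^ 2) ≤ (2 * σ₀ - 1) * (t₀ ^ 2 - (1 - σ₀)))
    (hMst : mtyM3 θ (-(r / R)) * η₀ ≤ Mst * t₀)
    (hm : ∀ u ∈ Icc 0 (mtyD1 θ), |mtyH1Deriv2 1 θ u| ≤ m)
    (hlam0 : 0 ≤ lam0)
    (hlam : b 1 * mtyLaplaceMoment θ (1 - r / R) - b 0 * mtyLaplaceMoment θ (-w₀) ≤ lam0)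
    (hN₀ : 0 ≤ fordSmoothW0 θ * (2 * σ₀ - 1) - m * η₀ ^ 2 / (2 * σ₀ - 1))
    (hquad : ∀ Y : ℝ, 0 ≤ Y →
      κ * (1 + Y) * ((fordSmoothW0 θ * δ + m * η₀ ^ 2 / δ) * ((2 * σ₀ - 1 + δ) ^ 2 + Y) +
          (fordSmoothW0 θ * (1 + δ) + m * η₀ ^ 2 / (2 * σ₀ - 1 + δ)) * (δ ^ 2 + Y)) ≤
        (fordSmoothW0 θ * (2 * σ₀ - 1) - m * η₀ ^ 2 / (2 * σ₀ - 1)) * ((δ ^ 2 + Y) * ((2 * σ₀ - 1 + δ) ^ 2 + Y)))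
    (hReg : ∀ β γ : ℝ, T_R < γ → riemannZeta (β + γ * I) = 0 → β ≤ 1 - 1 / (R * Real.log γ))
    (hRH : ∀ s : ℂ, riemannZeta s = 0 → 0 < s.re → s.re < 1 → |s.im| ≤ H → s.re = 1 / 2)
    (hN1 : KadiriStrip.coeffQ0 θ K b r δ κ σ₀ η₀ T_c t₀ Mst + lam0 * (r ^ 2 * Real.log ((K : ℝ) + 1) / R) +
      KadiriStrip.coeffQ1 K b r κ σ₀ T_c t₀ Mst m * η₀ + KadiriStrip.coeffQ2 K b δ κ σ₀ η₀ T_c m * η₀ ^ 2 ≤ 0)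
    (hN2 : fordSmoothW0 θ * (1 - κ) * (∑ k ∈ Finset.range K, b (k + 1)) / (2 * r) <
      b 1 * mtyLaplace θ (1 - r / R) - b 0 * mtyLaplace θ (-(r / R))) :
    KadiriStripEmpty T₀ r R := by
  intro β γ hz hγT hβlow hβup
  have hKr : (1 : ℝ) ≤ K := by exact_mod_cast hK
  have hγTc : T_c ≤ γ := by linarith
  have hγ7 : 7 ≤ γ := by linarith
  have hlogT : 0 < Real.log T_c := Real.log_pos (by linarith)
  have hlogγ : Real.log T_c ≤ Real.log γ := Real.log_le_log (by linarith) hγTc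
  have hlogγ0 : 0 < Real.log γ := hlogT.trans_le hlogγ
  -- `r log γ > 2`, so `β > 1/2`
  have hrlog : 2 < r * Real.log T_c := by
    by_contra h
    push Not at h
    have : 1 / 2 ≤ 1 / (r * Real.log T_c) := by
      rw [div_le_div_iff₀ (by norm_num) (by positivity)]; linarith
    linarith
  have hrlogγ : 2 < r * Real.log γ := by nlinarith
  have hβhalf : 1 / 2 < β := by
    have : 1 / (r * Real.log γ) < 1 / 2 := by
      rw [div_lt_div_iff₀ (by positivity) (by norm_num)]; linarith
    linarith
  -- the zero as an element of `Zeros`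
  have him : ((β : ℂ) + (γ : ℂ) * I).im = γ := by simp
  have hre : ((β : ℂ) + (γ : ℂ) * I).re = β := by simp
  have hmem := ZetaZeros.riemannZetaNontrivialZeros.mem_of_re_pos hz (by rw [hre]; linarith)
  -- the parameters at this height
  set η : ℝ := 1 / (r * Real.log γ) with hη
  set σ : ℝ := 1 - 1 / (R * Real.log (K * γ + t₀)) with hσ
  have hηpos : 0 < η := by positivity
  have hηη₀ : η ≤ η₀ := by
    rw [hη]; exact le_trans (one_div_le_one_div_of_le (by positivity) (by nlinarith)) hη₀
  have hlogKT : 0 < Real.log (K * T_c + t₀) := Real.log_pos (by nlinarith)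
  have hlogKγ : Real.log (K * T_c + t₀) ≤ Real.log (K * γ + t₀) :=
    Real.log_le_log (by nlinarith) (by nlinarith)
  have hσ₀σ : σ₀ ≤ σ := by
    rw [hσ]
    have := one_div_le_one_div_of_le (by positivity) (mul_le_mul_of_nonneg_left hlogKγ hR.le)
    linarith
  have hlogKγ0 : 0 < Real.log (K * γ + t₀) := hlogKT.trans_le hlogKγ
  have hσ1 : σ < 1 := by
    have : 0 < 1 / (R * Real.log (K * γ + t₀)) := by positivity
    rw [hσ]; linarith
  have hσhalf : 1 / 2 < σ := by linarith
  -- `β ≤ σ`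
  have hβσ : β ≤ σ := by
    have hlogle : Real.log γ ≤ Real.log (K * γ + t₀) := Real.log_le_log (by linarith) (by nlinarith)
    have := one_div_le_one_div_of_le (by positivity) (mul_le_mul_of_nonneg_left hlogle hR.le)
    rw [hσ]; linarith
  -- the inputs of the master inequality
  have hγR : T_R + t₀ ≤ γ := by linarith
  have hnear := near_zeros (K := K) hR ht₀ hH hTR2 hγR hσ hσhalf.le hReg hRH
  have hζ := zeta_ne_zero_line (K := K) hR ht₀ hH hTR2 hγR hσ hσhalf hReg hRH
  have hζ' : ∀ k ≤ K, riemannZeta (((σ + δ : ℝ) : ℂ) + (((k : ℝ) * γ : ℝ) : ℂ) * I) ≠ 0 := fun k _ ↦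
    riemannZeta_ne_zero_of_one_le_re (by simp; linarith)
  have hδpos : 0 < δ := by linarith
  have hB : ∀ y : ℝ, κ * ((fordLaplace (kadiriTest θ η) ((δ : ℂ) + y * I)).re +
        (fordLaplace (kadiriTest θ η) (((2 * σ - 1 + δ : ℝ) : ℂ) + y * I)).re) ≤
      (fordLaplace (kadiriTest θ η) (((0 : ℝ) : ℂ) + y * I)).re +
        (fordLaplace (kadiriTest θ η) (((2 * σ - 1 : ℝ) : ℂ) + y * I)).re :=
    KadiriBoundary.boundary_ineq hθ hθ' hηpos hηη₀ hσ₀half hσ₀σ hσ1.le hδpos hκ0 hm hN₀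
      (KadiriBoundary.rational_condition_of_quad hδpos hσ₀half hquad)
  -- the contradiction
  exact per_zero_contra hθ hθ' (ρ₀ := ⟨_, hmem⟩) hb hK hr hR hδ hδ1 hκ0 hκ1 hT_c ht₀ ht₀T hγTc hη hσ
    hσ₀ hη₀ hw₀ hσ₀half hη₀half hδσ₀ hσ₀δ hκΓ hA hSt hMst hm hlam0 hlam hζ hζ' hnear hB
    (by exact him) (by simp only; rw [hre]; exact hβlow) (by simp only; rw [hre]; exact hβσ) hN1 hN2

/-! ## Part D: glue for the iteration `R ↦ r` with regions above a height, without numerical RH -/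

/-- **The next round**: the region with constant `R` above the height `T_R ≤ T₀` and the empty
strip `(T₀, r, R)` give the region with constant `r` above the height `T₀` (no comparison of `r`
and `R`, no numerical input). [cite: MossinghoffTrudgian2015, §5] -/
theorem regionAbove_of_stripEmpty {r R T_R T₀ : ℝ}
    (hReg : ∀ β γ : ℝ, T_R < γ → riemannZeta (β + γ * I) = 0 → β ≤ 1 - 1 / (R * Real.log γ))
    (hTR : T_R ≤ T₀) (hE : KadiriStripEmpty T₀ r R) :
    ∀ β γ : ℝ, T₀ < γ → riemannZeta (β + γ * I) = 0 → β ≤ 1 - 1 / (r * Real.log γ) := by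
  intro β γ hγ hz
  by_contra hlt
  push Not at hlt
  exact hE β γ hz hγ hlt.le (hReg β γ (lt_of_le_of_lt hTR hγ) hz)

/-- **The initial region above a height `T ≥ 5`, unconditionally**: from the tree's explicit
(crude) zero-free region `1 − β ≥ 1/((4480 + 74172/log T) log|t|)` (`|t| ≥ T ≥ 5`,
`riemannZeta_one_sub_re_ge_explicit`), every zero `β + iγ` with `γ > T` has
`β ≤ 1 − 1/(R₀ log γ)` for any `R₀ ≥ 4480 + 74172/log T`. [cite: MossinghoffTrudgianYangRNT2024, §9] -/
theorem regionAbove_initial {T R₀ : ℝ} (hT : 5 ≤ T) (hR₀ : 4480 + 74172 / Real.log T ≤ R₀) :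
    ∀ β γ : ℝ, T < γ → riemannZeta (β + γ * I) = 0 → β ≤ 1 - 1 / (R₀ * Real.log γ) := by
  intro β γ hγ hz
  have hγabs : |γ| = γ := abs_of_pos (by linarith)
  have h := riemannZeta_one_sub_re_ge_explicit hT (by rw [hγabs]; exact hγ.le) hz
  rw [hγabs] at h
  have hlogγ : 0 < Real.log γ := Real.log_pos (by linarith)
  have hlogT : 0 < Real.log T := Real.log_pos (by linarith)
  have h74 : 0 ≤ 74172 / Real.log T := by positivity
  have hmono : 1 / (R₀ * Real.log γ) ≤ 1 / ((4480 + 74172 / Real.log T) * Real.log γ) :=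
    one_div_le_one_div_of_le (by positivity) (mul_le_mul_of_nonneg_right hR₀ hlogγ.le)
  linarith

/-- **Leaf (B) from an empty strip and a region above a height** (the form in which the certified
rounds deliver the large-height region of Mossinghoff–Trudgian–Yang's Theorem 1.3): if the region
with constant `R` holds above a height `T_R ≤ 3·10¹²` and the strip
`1 − 1/(5.558691 log γ) ≤ β ≤ 1 − 1/(R log γ)`, `γ > 3·10¹²`, is empty, then
`zero_free_region_mossinghoff_trudgian_yang_large_height`.
[cite: MossinghoffTrudgianYangRNT2024, §9 and Theorem 1.3] -/
theorem large_height_of_stripEmpty {R T_R : ℝ}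
    (hReg : ∀ β γ : ℝ, T_R < γ → riemannZeta (β + γ * I) = 0 → β ≤ 1 - 1 / (R * Real.log γ))
    (hTR : T_R ≤ 3 * 10 ^ 12) (hE : KadiriStripEmpty (3 * 10 ^ 12) 5.558691 R) :
    zero_free_region_mossinghoff_trudgian_yang_large_height := by
  intro σ t ht hσ hz
  exact hE σ t hz ht hσ (hReg σ t (lt_of_le_of_lt hTR ht) hz)

/-- The two-sided strip form of RH up to `H` from the tree's upper-half-plane form
`RiemannHypothesisUpTo H` (conjugate for negative ordinates). [folklore] -/
theorem rh_two_sided {H : ℝ} (h : DiophantineGeometry.RiemannHypothesisUpTo H) :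
    ∀ s : ℂ, riemannZeta s = 0 → 0 < s.re → s.re < 1 → |s.im| ≤ H → s.re = 1 / 2 := by
  intro s hs h0 _ hH
  have hmem := ZetaZeros.riemannZetaNontrivialZeros.mem_of_re_pos hs h0
  have him := ZetaZeros.riemannZetaNontrivialZeros.im_ne_zero hmem
  rcases lt_or_gt_of_ne him with hneg | hpos
  · -- conjugate zero
    have hmem' := ZetaZeros.riemannZetaNontrivialZeros.conj_mem hmem
    have hs' := ZetaZeros.riemannZetaNontrivialZeros.zeta_eq_zero hmem'
    have := h _ hs' (by simp; linarith) (by simp; rw [abs_of_neg hneg] at hH; linarith)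
    simpa using this
  · exact h s hs hpos (by rw [abs_of_pos hpos] at hH; exact hH)

end KadiriStrip3

end Literature.NumberTheory.LFunctions
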